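import Summits.BirchSwinnertonDyer.BirchSwinnertonDyer.Theorems.RamifiedHeegnerPairLeafCartanKernelZero
import Literature.NumberTheory.EllipticCurves.NonvanishingTwistsPrescribedInertSimpleZero
import HarnessLib

/-!
# Route `RamifiedHeegnerPair`, crux U₀ `LeafRankZeroUpperAtThree` (stmt-BirchSwinnertonDyer-26024) — the U₀ Cartan road's twist supply AS A NAMED PRINT FACT

HONEST FRAMING. One theorem: KERNEL₀'s wrapper (p771318) with its inline twist-supply hypothesis replaced by the NAMED Literature fact
`Literature.NumberTheory.EllipticCurves.friedbergHoffstein_exists_twist_simpleZero_inertAt_sq_splitTwo` (Friedberg–Hoffstein Thm. B, special case; p773715). Nothing is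
proved about any curve; item 26024 stays OPEN; BSD is proved for no curve. Lead prover bsd-line-rhp-p2 g54, 2026-08-30.
[cite: FriedbergHoffstein1995, Thm. B] [cite: JetchevSkinnerWan2017, §7.4.2 (c)] [cite: BumpFriedbergHoffstein1990, Theorem (Introduction, pp. 543–544)]
-/

set_option linter.dupNamespace false
set_option autoImplicit false

noncomputable section

open scoped Classical NumberField

open WeierstrassCurve NumberField IsDedekindDomain Literature Literature.NumberTheory.EllipticCurves
  Rat.HeightOneSpectrum CongruenceSubgroup
  Literature.NumberTheory.EllipticCurves.ModularForms
  Literature.NumberTheory.EllipticCurves.Rank1Residual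
  Literature.NumberTheory.EllipticCurves.Rank1Residual.Typed
  Literature.NumberTheory.QuadraticFields.Quadratic
  Literature.NumberTheory.Automorphic
  Summit.BirchSwinnertonDyer.Rank1Residual
  Summit.BirchSwinnertonDyer.Rank1Residual.Additive
  Summit.BirchSwinnertonDyer.BirchSwinnertonDyer.Theses.RamifiedHeegnerPair
  Summit.BirchSwinnertonDyer.BirchSwinnertonDyer.Theorems

namespace Summit.BirchSwinnertonDyer.BirchSwinnertonDyer.Theorems.LeafCartanKernelZero

/-- **KERNEL₀ with the twist supply BY NAME**: ROAD₀(`HabNs`) for the rank-zero crux U₀ from the print (GZK, entireness, modularity, JL, CO), the NAMED supply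
`friedbergHoffstein_exists_twist_simpleZero_inertAt_sq_splitTwo`, the leaf Cartan display (inline; rank-free) and L₁ — `leafCartanRoadZero_of_display_of_supply_of_lowerRankOne`
(p771318) with its inline supply hypothesis discharged by the name. CONDITIONAL; credits nothing. [cite: FriedbergHoffstein1995, Thm. B] [cite: KohenPacetti2016, Thm. 3.6, Thm. 3.7] -/
theorem leafCartanRoadZero_of_display_of_namedSupply_of_lowerRankOne
    (hGZK : rank_eq_analyticRank_of_analyticRank_le_one) (hmod : hasEntireLFunction_rat)
    (hnf : exists_isNewformOf) (hJL : nonempty_shimuraParametrizationData)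
    (hCO : PastenShimura2024_componentOrders)
    (hFH : friedbergHoffstein_exists_twist_simpleZero_inertAt_sq_splitTwo)
    (hDisp : ∀ (V : WeierstrassCurve ℚ) [V.IsElliptic] [V.IsGloballyMinimal], ¬ V.HasCM → Addv V 3 → SubGss V 3 → Surj V 3 →
      ∀ (N : ℕ) [NeZero N] (K : Type) [Field K] [NumberField K] (S C : Finset ℕ)
      (Dt : ModularParametrizationData V N)
      (X : ShimuraCurveData (∏ q ∈ S, q) (N / ∏ q ∈ S, q))
      (W' : WeierstrassCurve ℚ) [W'.IsElliptic] (P₀ : ShimuraParametrizationData X W'),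
      V.conductorNorm ℤ = N → IsImaginaryQuadratic K → NumberField.discr K < -4 → Even S.card →
      (∀ ℓ ∈ S, ℓ.Prime ∧ ℓ ∣ N ∧ ¬ ℓ ^ 2 ∣ N ∧
        ((Ideal.span {(ℓ : ℤ)}).primesOver (𝓞 K)).ncard = 1 ∧ ¬ (ℓ : ℤ) ∣ NumberField.discr K) →
      (∀ q ∈ C, ∃ _ : Fact q.Prime, q ≠ 3 ∧ q ^ 2 ∣ N ∧ ¬ q ^ 3 ∣ N ∧
        3 ∣ (V.baseChange ℚ_[q]).localTamagawaNumber ℤ_[q] ∧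
        ((Ideal.span {(q : ℤ)}).primesOver (𝓞 K)).ncard = 1 ∧ ¬ (q : ℤ) ∣ NumberField.discr K) →
      (∀ ℓ : ℕ, ℓ.Prime → ℓ ∣ N → ℓ ∉ S → ℓ ∉ C → ((Ideal.span {(ℓ : ℤ)}).primesOver (𝓞 K)).ncard = 2) →
      ¬ (3 : ℤ) ∣ Dt.c → P₀.IsMinimalFor V →
      ∃ (P : (V.baseChange K).toAffine.Point) (degC : ℕ), 0 < degC ∧
        padicValNat 3 degC + C.card = padicValNat 3 P₀.deg ∧
        LDerivEK V K =
          8 * (Real.pi : ℂ) ^ 2 * peterssonProduct (Gamma0 N) 2 Dt.f Dt.f /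
              ((((Units.torsionOrder K : ℝ) / 2) ^ 2 * √|(NumberField.discr K : ℝ)| : ℝ) : ℂ) *
            ((P.canonicalHeight : ℂ) / (degC : ℂ)) ∧
        (¬ IsOfFinAddOrder P → ∀ (q : ℕ) [Fact q.Prime] (s : ℕ), q ∉ S → q ∉ C →
          s ≤ padicValNat 3 ((V.baseChange ℚ_[q]).localTamagawaNumber ℤ_[q]) →
          padicValNat 3 (Nat.card (AddCommGroup.primaryComponent (V.baseChange K).sha 3)) + 2 * s ≤
            2 * padicValNat 3 (AddSubgroup.zmultiples P).index))
    (hL1 : Gss2LowerAtThreeRankOne)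
    (W : WeierstrassCurve ℚ) [W.IsElliptic] [W.IsGloballyMinimal] (N : ℕ) [NeZero N]
    (Dt : ModularParametrizationData W N)
    (hCM : ¬ W.HasCM) (hadd : Addv W 3) (hsub : SubGss W 3) (hr : W.analyticRank = 0) (hN : W.conductorNorm ℤ = N)
    (hc : ¬ (3 : ℤ) ∣ Dt.c) (hsurj : Surj W 3)
    (C : Finset ℕ)
    (hCdata : ∀ q ∈ C, ∃ _ : Fact q.Prime, q ≠ 3 ∧ q ^ 2 ∣ W.conductorNorm ℤ ∧ ¬ q ^ 3 ∣ W.conductorNorm ℤ ∧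
      3 ∣ (W.baseChange ℚ_[q]).localTamagawaNumber ℤ_[q])
    (q₁ : ℕ) (hq₁3 : q₁ ≠ 3)
    (hmono : ∀ (q : ℕ) [Fact q.Prime], q ∉ C → q ≠ q₁ → ¬ 3 ∣ (W.baseChange ℚ_[q]).localTamagawaNumber ℤ_[q]) :
    MissingUpperBoundAt W 3 :=
  leafCartanRoadZero_of_display_of_supply_of_lowerRankOne hGZK hmod hnf hJL hCO (fun W _ hw S C hS hSe hC B => hFH W hw S C hS hSe hC B)
    hDisp hL1 W N Dt hCM hadd hsub hr hN hc hsurj C hCdata q₁ hq₁3 hmono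

end Summit.BirchSwinnertonDyer.BirchSwinnertonDyer.Theorems.LeafCartanKernelZero

end
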